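import Mathlib.MeasureTheory.Measure.OpenPos
import Mathlib.Topology.Connected.Basic
import HarnessLib

/-!
# Locally null / locally conull sets have constant type on connected pieces (open partition lemma)

Cycle-2 tool (H4) of line `third-law-current-floor`, crux `BECConjugateDomination.HardCoreExtension`
(stmt-AtomisticToContinuum-11786). In a topological measure space whose measure charges every non-empty open set,
let `Z` be any set and `G` an open set on which `Z` is LOCALLY TRIVIAL: every point of `G` has a neighbourhood
`U ⊆ G` with `μ(U ∩ Z) = 0` or `μ(U \ Z) = 0`. Then the two sets `A = {locally null}`, `B = {locally conull}` are
open, disjoint and cover `G`, so every preconnected `C ⊆ G` lies in one of them (`IsPreconnected.subset_or_subset`);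
in a second-countable space "locally null on `C`" upgrades to `μ(C ∩ Z) = 0` (`Measure.null_of_locally_null`).
This replaces chains of overlapping cubes in the positivity argument for hard cores on the connected components
of the free region.
-/

noncomputable section

namespace Summit.AtomisticToContinuum.BoseEinsteinCondensation.Cruxes.HardCoreExtension.ThirdLawCurrentFloorAlt

open MeasureTheory Filter Set Topology

section OpenPartition

variable {α : Type*} [TopologicalSpace α] [MeasurableSpace α] (μ : Measure α) [μ.IsOpenPosMeasure]

omit [μ.IsOpenPosMeasure] in
/-- The set of points near which `Z` is null is open. [folklore] -/
theorem isOpen_setOf_locallyNull (Z : Set α) : IsOpen {x : α | ∃ U ∈ 𝓝 x, μ (U ∩ Z) = 0} := by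
  refine isOpen_iff_mem_nhds.2 fun x hx => ?_
  obtain ⟨U, hU, hUZ⟩ := hx
  filter_upwards [interior_mem_nhds.2 hU] with y hy
  exact ⟨interior U, isOpen_interior.mem_nhds hy, measure_mono_null (inter_subset_inter_left _ interior_subset) hUZ⟩

omit [μ.IsOpenPosMeasure] in
/-- The set of points near which `Z` is conull is open. [folklore] -/
theorem isOpen_setOf_locallyConull (Z : Set α) : IsOpen {x : α | ∃ U ∈ 𝓝 x, μ (U \ Z) = 0} := by
  refine isOpen_iff_mem_nhds.2 fun x hx => ?_
  obtain ⟨U, hU, hUZ⟩ := hx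
  filter_upwards [interior_mem_nhds.2 hU] with y hy
  exact ⟨interior U, isOpen_interior.mem_nhds hy, measure_mono_null (Set.sdiff_subset_sdiff interior_subset Subset.rfl) hUZ⟩

/-- No point is both locally null and locally conull for a measure charging open sets. [folklore] -/
theorem not_locallyNull_and_locallyConull (Z : Set α) (x : α) :
    ¬ ((∃ U ∈ 𝓝 x, μ (U ∩ Z) = 0) ∧ (∃ U ∈ 𝓝 x, μ (U \ Z) = 0)) := by
  rintro ⟨⟨U, hU, hUZ⟩, ⟨V, hV, hVZ⟩⟩
  have hW : interior (U ∩ V) ∈ 𝓝 x := interior_mem_nhds.2 (inter_mem hU hV)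
  have hne : (interior (U ∩ V)).Nonempty := ⟨x, mem_of_mem_nhds hW⟩
  have hpos := (isOpen_interior.measure_pos μ hne).ne'
  apply hpos
  refine measure_mono_null (fun y hy => ?_) (measure_union_null hUZ hVZ)
  have hy' : y ∈ U ∩ V := interior_subset hy
  by_cases hyZ : y ∈ Z
  · exact Or.inl ⟨hy'.1, hyZ⟩
  · exact Or.inr ⟨hy'.2, hyZ⟩

/-- **Open partition lemma.** If `Z` is locally trivial on the open set `G` (every point of `G` has a neighbourhood
`U` with `μ(U ∩ Z) = 0` or `μ(U \ Z) = 0`), then every preconnected `C ⊆ G` is entirely locally null or entirely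
locally conull. [folklore] -/
theorem locallyNull_or_locallyConull_of_isPreconnected {G Z C : Set α}
    (hloc : ∀ x ∈ G, (∃ U ∈ 𝓝 x, μ (U ∩ Z) = 0) ∨ (∃ U ∈ 𝓝 x, μ (U \ Z) = 0))
    (hC : IsPreconnected C) (hCG : C ⊆ G) :
    (∀ x ∈ C, ∃ U ∈ 𝓝 x, μ (U ∩ Z) = 0) ∨ (∀ x ∈ C, ∃ U ∈ 𝓝 x, μ (U \ Z) = 0) := by
  have hdisj : Disjoint {x : α | ∃ U ∈ 𝓝 x, μ (U ∩ Z) = 0} {x : α | ∃ U ∈ 𝓝 x, μ (U \ Z) = 0} :=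
    Set.disjoint_left.2 fun x hx hx' => not_locallyNull_and_locallyConull μ Z x ⟨hx, hx'⟩
  have hcover : C ⊆ {x : α | ∃ U ∈ 𝓝 x, μ (U ∩ Z) = 0} ∪ {x : α | ∃ U ∈ 𝓝 x, μ (U \ Z) = 0} :=
    fun x hx => hloc x (hCG hx)
  rcases hC.subset_or_subset (isOpen_setOf_locallyNull μ Z) (isOpen_setOf_locallyConull μ Z) hdisj hcover with h | h
  · exact Or.inl fun x hx => h hx
  · exact Or.inr fun x hx => h hx

omit [μ.IsOpenPosMeasure] in
/-- **From locally null to null** on a second-countable space: if every point of `C` has a neighbourhood `U` with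
`μ(U ∩ Z) = 0` then `μ(C ∩ Z) = 0`; dually for conull. [folklore] -/
theorem measure_inter_eq_zero_of_locallyNull [SecondCountableTopology α] {Z C : Set α}
    (h : ∀ x ∈ C, ∃ U ∈ 𝓝 x, μ (U ∩ Z) = 0) : μ (C ∩ Z) = 0 := by
  refine measure_null_of_locally_null _ fun x hx => ?_
  obtain ⟨U, hU, hUZ⟩ := h x hx.1
  refine ⟨(C ∩ Z) ∩ U, inter_mem_nhdsWithin _ hU, ?_⟩
  exact measure_mono_null (fun y hy => (⟨hy.2, hy.1.2⟩ : y ∈ U ∩ Z)) hUZ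

omit [μ.IsOpenPosMeasure] in
/-- Dual form: locally conull on `C` gives `μ(C \ Z) = 0`. [folklore] -/
theorem measure_diff_eq_zero_of_locallyConull [SecondCountableTopology α] {Z C : Set α}
    (h : ∀ x ∈ C, ∃ U ∈ 𝓝 x, μ (U \ Z) = 0) : μ (C \ Z) = 0 := by
  refine measure_null_of_locally_null _ fun x hx => ?_
  obtain ⟨U, hU, hUZ⟩ := h x hx.1
  refine ⟨(C \ Z) ∩ U, inter_mem_nhdsWithin _ hU, ?_⟩
  exact measure_mono_null (fun y hy => (⟨hy.2, hy.1.2⟩ : y ∈ U \ Z)) hUZ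

/-- **Open partition lemma, closed form** (registered sub-goal `openPartition_c2` of the crux item; restatement of
`locallyNull_or_locallyConull_of_isPreconnected`). [folklore] -/
theorem openPartition_c2 :
    ∀ {α : Type} [TopologicalSpace α] [MeasurableSpace α] (μ : MeasureTheory.Measure α) [μ.IsOpenPosMeasure] {G Z C : Set α}, (∀ x ∈ G, (∃ U ∈ nhds x, μ (U ∩ Z) = 0) ∨ (∃ U ∈ nhds x, μ (U \ Z) = 0)) → IsPreconnected C → C ⊆ G → (∀ x ∈ C, ∃ U ∈ nhds x, μ (U ∩ Z) = 0) ∨ (∀ x ∈ C, ∃ U ∈ nhds x, μ (U \ Z) = 0) :=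
  fun μ _ _ _ _ hloc hC hCG => locallyNull_or_locallyConull_of_isPreconnected μ hloc hC hCG

end OpenPartition

end Summit.AtomisticToContinuum.BoseEinsteinCondensation.Cruxes.HardCoreExtension.ThirdLawCurrentFloorAlt

end
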